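import Literature.NumberTheory.Automorphic.WhittakerTower
import Literature.NumberTheory.Automorphic.ColumnGroupFourier
import Literature.NumberTheory.Automorphic.CuspidalTowerGeneric
import Literature.NumberTheory.Automorphic.MirabolicTowerGroups
import HarnessLib

/-!
# The two Whittaker towers agree; genericity for `whittakerDepth`
(Cogdell (2004), §1.1; Shalika (1974), Thm. 5.9)

Topic `NumberTheory/Automorphic`; namespace `Literature.NumberTheory.Automorphic`. The tree carries two
formalisations of the column-by-column Fourier–Whittaker tower of a function `φ` on `GL_n(𝔸_K)`:

* `whittakerDepth d φ` (`WhittakerTower`): normalised transforms `colTransform c` over the Tate box of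
  the *subgroup* `Y_c(𝔸_K) = U_{[c,c]}(𝔸_K)` for its Haar measure `Measure.haar`, character
  `conj ψ(y_{c-1,c})`;
* `fwTower ν φ c` (`CuspidalTowerGeneric`): normalised coefficients `colCoeff` over Tate's box of the
  *coordinate space* `𝔸_K^{c+1}` (column unipotent `colUnipotent`), character `conj ψ(∑ e_i v_i)`.

This file proves that they are the same function at every level:

* `colVecGL_eq_colUnipotent` — the column matrices agree (`colVecGL (c+1) x = u(x ∘ e)` for the index
  bijection `Fin.castLEOrderIso : Fin (c+1) ≃o ColIdx n (c+1)` of Mathlib);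
* `colTransform_succ_eq_colCoeff` — **`colTransform (c+1) f = colCoeff (c+1 ≤ n) ν f e_c`** for every
  additive Haar measure `ν` on `𝔸_K^{c+1}`: every Haar measure of `Y_{c+1}(𝔸_K)` is a multiple of the
  transported product measure (`haar_eq_smul_map_colVec`, `ColumnGroupFourier`), the multiple cancels
  in the normalised average, and the product measure is reindexed along `Fin.castLEOrderIso`
  (Mathlib `measurePreserving_piCongrLeft`); `colCoeff` does not depend on `ν`
  (`colCoeff_eq_of_isAddHaarMeasure`);
* `whittakerDepth_eq_fwTower` — **`whittakerDepth c φ = fwTower ν φ c`** for all `c` (downward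
  induction from `Φ_{n-1} = φ`);
* `eq_zero_of_whittakerDepth_zero_eq_zero` — **genericity transported**: a continuous, left
  `GL_n(K)`-invariant `φ` satisfying the cusp conditions whose Whittaker coefficient `whittakerDepth 0 φ`
  vanishes identically is zero (`eq_zero_of_fwTower_zero_eq_zero`; Shalika (1974), Thm. 5.9). By
  `WhittakerTowerCoeff` this is the statement for the global Whittaker coefficient `whittakerCoeff`.

Everything is proved.

## References

* J. W. Cogdell, in Bernstein–Gelbart (eds.), *An Introduction to the Langlands Program* (2004),
  §1.1 [CogdellAnalyticTheory2004].
* J. A. Shalika, Ann. of Math. 100 (1974), §5, Thm. 5.9 [Shalika1974].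
-/

noncomputable section

open scoped Matrix ComplexConjugate ENNReal NNReal Pointwise
open NumberField IsDedekindDomain MeasureTheory MeasureTheory.Measure Function Set
open Literature.LinearAlgebra.Matrix

namespace Literature.NumberTheory.Automorphic

/-! ### The index bijection and the two column matrices -/

section Algebra

variable {n : ℕ} {R : Type*} [CommRing R]

/-- The index bijection `Fin (c+1) ≃ ColIdx n (c+1) = {j : Fin n // j < c+1}` (`c + 1 ≤ n`) is Mathlib's
`Fin.castLEOrderIso h` (`i ↦ ⟨Fin.castLE h i, _⟩`); on `Fin n` it is `Fin.castLE` (definitional).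
[folklore] -/
theorem coe_castLEOrderIso_apply {c : ℕ} (h : c + 1 ≤ n) (i : Fin (c + 1)) :
    ((Fin.castLEOrderIso h i : ColIdx n (c + 1)) : Fin n) = Fin.castLE h i := rfl

/-- **The two column matrices agree**: `colVecGL (c+1) x = u(x ∘ e)` with `e = Fin.castLEOrderIso h`
(Mathlib's `Fin (c+1) ≃o {j : Fin n // j < c+1}`). [folklore] -/
theorem colVecGL_eq_colUnipotent {c : ℕ} (h : c + 1 ≤ n) (x : ColIdx n (c + 1) → R) :
    colVecGL (c + 1) x = colUnipotent n h (Multiplicative.ofAdd fun i => x (Fin.castLEOrderIso h i)) := by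
  refine Units.ext (Matrix.ext fun i j => ?_)
  rw [colUnipotent_apply_val, colVecGL, coe_unitriangularGL, unitriangularOfEntries_apply]
  by_cases hij : i = j
  · subst hij
    rw [if_pos rfl, if_pos rfl]
    by_cases hi : (i : ℕ) < c + 1
    · rw [dif_pos hi, if_neg (by omega), add_zero]
    · rw [dif_neg hi, add_zero]
  · rw [if_neg hij, if_neg hij, zero_add]
    by_cases hlt : i < j
    · rw [if_pos hlt, colEntries]
      by_cases hi : (i : ℕ) < c + 1
      · by_cases hj : (j : ℕ) = c + 1
        · rw [dif_pos ⟨hi, hj⟩, dif_pos hi, if_pos hj]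
          rfl
        · rw [dif_neg (fun hh => hj hh.2), dif_pos hi, if_neg hj]
      · rw [dif_neg (fun hh => hi hh.1), dif_neg hi]
    · rw [if_neg hlt]
      by_cases hi : (i : ℕ) < c + 1
      · rw [dif_pos hi, if_neg]
        have h1 : j < i := lt_of_le_of_ne (not_lt.1 hlt) (Ne.symm hij)
        have h2 := Fin.lt_def.1 h1
        omega
      · rw [dif_neg hi]

end Algebra

/-! ### `colTransform (c+1) = colCoeff (c+1 ≤ n)` -/

section Transform

variable {n : ℕ} {K : Type} [Field K] [NumberField K]
variable [MeasurableSpace (AdeleRing (𝓞 K) K)] [BorelSpace (AdeleRing (𝓞 K) K)]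
variable [MeasurableSpace (GL (Fin n) (AdeleRing (𝓞 K) K))] [BorelSpace (GL (Fin n) (AdeleRing (𝓞 K) K))]

/-- **The column transform of `WhittakerTower` is the column coefficient of `MirabolicFourierStage`**:
for `c + 1 < n`, `f : GL_n(𝔸_K) → ℂ`, `g ∈ GL_n(𝔸_K)` and every additive Haar measure `ν` on
`𝔸_K^{c+1}`, `colTransform (c+1) f g = colCoeff (c+1 ≤ n) ν f e_c g`. [folklore] -/
theorem colTransform_succ_eq_colCoeff {c : ℕ} (hc : c + 1 < n)
    (f : GL (Fin n) (AdeleRing (𝓞 K) K) → ℂ) (g : GL (Fin n) (AdeleRing (𝓞 K) K))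
    (ν : Measure (Fin (c + 1) → AdeleRing (𝓞 K) K)) [ν.IsAddHaarMeasure] :
    colTransform (c + 1) hc (Nat.succ_pos c) f g = colCoeff hc.le ν f (lastVec c K) g := by
  haveI := locallyCompactSpace_adeleRing' K
  haveI := secondCountableTopology_adeleRing K
  haveI := t2Space_adeleRing K
  haveI : BorelSpace (Fin (c + 1) → AdeleRing (𝓞 K) K) := Pi.borelSpace
  haveI : BorelSpace (ColIdx n (c + 1) → AdeleRing (𝓞 K) K) := Pi.borelSpace
  -- a product Haar measure on the coordinates
  obtain ⟨lam, hlam⟩ : ∃ lam : Measure (AdeleRing (𝓞 K) K), lam.IsAddHaarMeasure := ⟨Measure.addHaar, inferInstance⟩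
  rw [colCoeff_eq_of_isAddHaarMeasure hc.le (Measure.pi fun _ : Fin (c + 1) => lam) ν, colCoeff_apply, colTransform]
  -- Haar measure of `Y_{c+1}(𝔸_K)` in coordinates
  obtain ⟨a, ha0, ha, hμ⟩ := haar_eq_smul_map_colVec (n := n) (K := K) (c + 1) hc lam
    (Measure.haar : Measure ↥(adelicColRange n K (c + 1) (c + 1)))
  set E := colVecHomeomorph (n := n) (K := K) (c + 1) hc with hE
  have hEm : MeasurableEmbedding E := E.toMeasurableEquiv.measurableEmbedding
  have hDm : MeasurableSet (Set.pi Set.univ fun _ : ColIdx n (c + 1) => adeleFundamentalDomain K) :=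
    MeasurableSet.univ_pi fun _ => measurableSet_adeleFundamentalDomain K
  have hbox : colRangeTateDomain n K (c + 1) (c + 1) =
      E '' Set.pi Set.univ (fun _ : ColIdx n (c + 1) => adeleFundamentalDomain K) :=
    (image_colVecHomeomorph_pi (c + 1) hc).symm
  -- the reindexing `R : 𝔸^{Fin (c+1)} → 𝔸^{ColIdx}` preserves the product measures and the boxes
  obtain ⟨Rm, hRm⟩ : ∃ Rm : (Fin (c + 1) → AdeleRing (𝓞 K) K) ≃ᵐ (ColIdx n (c + 1) → AdeleRing (𝓞 K) K),
      Rm = MeasurableEquiv.piCongrLeft (fun _ : ColIdx n (c + 1) => AdeleRing (𝓞 K) K) ((Fin.castLEOrderIso hc.le).toEquiv) :=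
    ⟨_, rfl⟩
  have hRmp : MeasurePreserving Rm (Measure.pi fun _ : Fin (c + 1) => lam)
      (Measure.pi fun _ : ColIdx n (c + 1) => lam) := by
    rw [hRm]
    exact measurePreserving_piCongrLeft (fun _ : ColIdx n (c + 1) => lam) ((Fin.castLEOrderIso hc.le).toEquiv)
  have hRme : MeasurableEmbedding Rm := Rm.measurableEmbedding
  have hRpre : Rm ⁻¹' Set.pi Set.univ (fun _ : ColIdx n (c + 1) => adeleFundamentalDomain K) =
      piFundamentalDomain K (Fin (c + 1)) := by
    rw [hRm, MeasurableEquiv.coe_piCongrLeft, Equiv.piCongrLeft_preimage_univ_pi]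
    rfl
  -- the two matrices and the character agree along `R`
  have hmat : ∀ v : Fin (c + 1) → AdeleRing (𝓞 K) K,
      ((E (Rm v) : ↥(adelicColRange n K (c + 1) (c + 1))) : GL (Fin n) (AdeleRing (𝓞 K) K)) =
        colUnipotent n hc.le (Multiplicative.ofAdd v) := by
    intro v
    rw [hE, colVecHomeomorph_apply, coe_colVecY, colVecGL_eq_colUnipotent hc.le]
    congr 2
    funext i
    rw [hRm]
    exact MeasurableEquiv.piCongrLeft_apply_apply ((Fin.castLEOrderIso hc.le).toEquiv) (β := fun _ => AdeleRing (𝓞 K) K) v i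
  have hchar : ∀ v : Fin (c + 1) → AdeleRing (𝓞 K) K,
      ((colUnipotent n hc.le (Multiplicative.ofAdd v) : GL (Fin n) (AdeleRing (𝓞 K) K)) :
        Matrix (Fin n) (Fin n) (AdeleRing (𝓞 K) K)) ⟨c + 1 - 1, by omega⟩ ⟨c + 1, hc⟩ =
        ∑ i, algebraMap K (AdeleRing (𝓞 K) K) (lastVec c K i) * v i := by
    intro v
    have e1 : (⟨c + 1 - 1, by omega⟩ : Fin n) = Fin.castLE hc.le (Fin.last c) := Fin.ext (by simp)
    rw [e1, colUnipotent_apply_col hc.le hc v (Fin.last c), sum_lastVec_mul]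
  -- box volume and box integral in coordinates
  have hvol : (Measure.haar : Measure ↥(adelicColRange n K (c + 1) (c + 1))) (colRangeTateDomain n K (c + 1) (c + 1)) =
      a * (Measure.pi fun _ : Fin (c + 1) => lam) (piFundamentalDomain K (Fin (c + 1))) := by
    rw [hμ, Measure.smul_apply, hbox, Measure.map_apply E.continuous.measurable (hEm.measurableSet_image.2 hDm),
      Set.preimage_image_eq _ E.injective, smul_eq_mul, ← hRpre, hRmp.measure_preimage_emb hRme]
  have hint : ∫ y in colRangeTateDomain n K (c + 1) (c + 1),
      f ((y : GL (Fin n) (AdeleRing (𝓞 K) K)) * g) *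
        conj (adeleAddChar K (((y : GL (Fin n) (AdeleRing (𝓞 K) K)) :
          Matrix (Fin n) (Fin n) (AdeleRing (𝓞 K) K)) ⟨c + 1 - 1, by omega⟩ ⟨c + 1, hc⟩) : ℂ)
      ∂(Measure.haar : Measure ↥(adelicColRange n K (c + 1) (c + 1))) =
      a.toReal • ∫ v in piFundamentalDomain K (Fin (c + 1)),
        conj (adeleAddChar K (∑ i, algebraMap K (AdeleRing (𝓞 K) K) (lastVec c K i) * v i) : ℂ) *
          f (colUnipotent n hc.le (Multiplicative.ofAdd v) * g) ∂(Measure.pi fun _ : Fin (c + 1) => lam) := by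
    rw [hμ, Measure.restrict_smul, integral_smul_measure, hbox, hEm.restrict_map, hEm.integral_map,
      Set.preimage_image_eq _ E.injective, ← hRmp.setIntegral_preimage_emb hRme, hRpre]
    congr 1
    refine setIntegral_congr_fun (measurableSet_piFundamentalDomain K (Fin (c + 1))) fun v _ => ?_
    simp only [hmat v, hchar v]
    exact mul_comm _ _
  have ha' : a.toReal ≠ 0 := ENNReal.toReal_ne_zero.2 ⟨ha0, ha⟩
  rw [hint, hvol, ENNReal.toReal_mul, mul_inv, smul_smul]
  congr 1
  rw [mul_comm ((a.toReal)⁻¹), mul_assoc, inv_mul_cancel₀ ha', mul_one]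

/-- **The two towers agree**: `whittakerDepth c φ = fwTower ν φ c` for every `c` (both are `φ` for
`n ≤ c + 1`, and both obey the recursion `Φ_c = T_{c+1} Φ_{c+1}` with `T_{c+1}` identified by
`colTransform_succ_eq_colCoeff`). [cite: CogdellAnalyticTheory2004, §1.1] -/
theorem whittakerDepth_eq_fwTower (ν : ∀ m : ℕ, Measure (Fin m → AdeleRing (𝓞 K) K))
    [hν : ∀ m, (ν m).IsAddHaarMeasure] (φ : GL (Fin n) (AdeleRing (𝓞 K) K) → ℂ) :
    ∀ c : ℕ, whittakerDepth c φ = fwTower K ν φ c := by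
  -- downward induction on `c`, through `k = n - 1 - c`
  suffices h : ∀ k c : ℕ, n - 1 - c = k → whittakerDepth c φ = fwTower K ν φ c from
    fun c => h _ c rfl
  intro k
  induction k with
  | zero =>
    intro c hk
    have e : whittakerDepth c φ = φ := by
      funext g
      simp [whittakerDepth, whittakerIter, hk]
    rw [e, fwTower_of_lt ν φ (by omega)]
  | succ k ih =>
    intro c hk
    have hc : c + 1 < n := by omega
    have h1 := whittakerDepth_pred (d := c + 1) (by omega) hc φ
    rw [Nat.add_sub_cancel] at h1
    rw [h1, ih (c + 1) (by omega)]
    funext g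
    rw [colTransform_succ_eq_colCoeff hc _ g (ν (c + 1)), fwTower_of_le ν φ (by omega) g]

/-- **Genericity of cusp forms for the Whittaker coefficient of `WhittakerTower`** (Shalika (1974),
Thm. 5.9, mean-square form): a continuous, left `GL_n(K)`-invariant `φ : GL_n(𝔸_K) → ℂ` satisfying the
cusp conditions `CuspConditionGL n K φ k` (`0 < k < n`) whose Whittaker coefficient
`whittakerDepth 0 φ` vanishes identically is identically zero (`eq_zero_of_fwTower_zero_eq_zero` and
`whittakerDepth_eq_fwTower`). [cite: Shalika1974, §5 Thm. 5.9] -/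
theorem eq_zero_of_whittakerDepth_zero_eq_zero {φ : GL (Fin n) (AdeleRing (𝓞 K) K) → ℂ}
    (hφc : Continuous φ)
    (hinv : ∀ (δ : GL (Fin n) K) (x : GL (Fin n) (AdeleRing (𝓞 K) K)), φ (ratGL K δ * x) = φ x)
    (hcusp : ∀ k, 0 < k → k < n → CuspConditionGL n K φ k)
    (h0 : ∀ x, whittakerDepth 0 φ x = 0) (x : GL (Fin n) (AdeleRing (𝓞 K) K)) : φ x = 0 := by
  haveI := locallyCompactSpace_adeleRing' K
  haveI := secondCountableTopology_adeleRing K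
  haveI := t2Space_adeleRing K
  obtain ⟨lam, hlam⟩ : ∃ lam : Measure (AdeleRing (𝓞 K) K), lam.IsAddHaarMeasure := ⟨Measure.addHaar, inferInstance⟩
  set ν : ∀ m : ℕ, Measure (Fin m → AdeleRing (𝓞 K) K) := fun m => Measure.pi fun _ : Fin m => lam with hν
  haveI : ∀ m, (ν m).IsAddHaarMeasure := fun m => by
    haveI : BorelSpace (Fin m → AdeleRing (𝓞 K) K) := Pi.borelSpace
    rw [hν]
    infer_instance
  refine eq_zero_of_fwTower_zero_eq_zero ν hφc hinv hcusp (fun y => ?_) x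
  rw [← whittakerDepth_eq_fwTower ν φ 0]
  exact h0 y

end Transform

end Literature.NumberTheory.Automorphic
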